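import Summits.ResolutionOfSingularities.ResolutionOfSingularities.Theorems.FrobeniusClosingPatchingRelPerfectConeDepthLadderEnd
import HarnessLib

/-!
# Crux `PatchingRelPerfect` (stmt-ResolutionOfSingularities-16161), chain W5.2 — rung «r-cone-ℓ», the LADDER II: the state of
# the ladder and ONE RUNG (blowing up the vertex)

[OURS · L1 W5.2 · rung tool] Replaces the role of NO printed item; NOT a statement of the manuscript under review; fact-free.
AI-written (AI review is weaker than expert review).

`LadderState I X g M 𝓗 E A B a b z` records a stage of the ladder for `I ⊆ S` on a modification `g : X → Spec S`: `X` integral,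
Noetherian, regular; `g` a blowing up cosupported in the closed point; the FORMAT `I𝒪_X = M · (𝓗 · mono(A ++ [(E,a)]) ⊔ mono(B ++ [(E,b)]))`
(`M` locally principal, `A`, `B` on one boundary); the VERTEX `z` (closed, over the closed point) where `𝒪_{X,z}` is regular of
dimension `4` with a regular system of parameters `c`, `𝓗_z = (c₁c₂ + c₃²)`, `E_z = (c₀)`, the other carriers missing `z`; and
simple normal crossings of `𝓗 :: carriers` at every other point over the closed point.  `LadderState.step`: blowing up the
vertex (any `σ` with `IsBlowup σ 𝓘_{{z}}` for which the VERTEX FIBRE THEOREM holds — hypothesis `hfib`, the statement of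
`ConeDepth.vertex_fibre`) produces a state on `X'` with exponents `(a + 2 - m, b - m)`, `m = min (a+2) b`
(`σ^*𝓗 = E'²σᶜ(𝓗,2)`, `σ^*E = E'σᶜ(E,1)`, `step_algebra`; regularity by Liu 8.1.19 (a); closedness of the new vertex by the
dimension count `IsBlowup.isClosed_singleton_of_ringKrullDim_eq`; simple normal crossings over `z` by `hfib`, elsewhere by
`sncWithAt_map_of_isIso`).  `conclusion_of_zero`: at `b = 0` the END (`coneEnd`) applies.
-/

set_option linter.dupNamespace false

noncomputable section

open CategoryTheory CategoryTheory.Limits AlgebraicGeometry TopologicalSpace IsLocalRing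
open Literature.AlgebraicGeometry.Resolution
open Scheme.IdealSheafData

namespace Summit.ResolutionOfSingularities.ResolutionOfSingularities.Theorems

universe u

namespace ConeDepth

/-! ## §4 The state of the ladder and one rung step -/

/-- [OURS · L1 W5.2 · rung «r-cone-ℓ»] **A STATE OF THE VERTEX-BLOWUP LADDER** for `I ⊆ S` on a modification `g : X ⟶ Spec S`: `X` integral, Noetherian and
regular; `g` a blowing up along an ideal sheaf cosupported in the closed point; the FORMAT
`I𝒪_X = M · (𝓗 · mono(A ++ [(E, a)]) ⊔ mono(B ++ [(E, b)]))` with `M` locally principal and `A`, `B` two exponent lists on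
the same boundary; a closed point `z` over the closed point (the VERTEX) where `𝒪_{X,z}` is regular of dimension `4` with a
regular system of parameters `c` in which `𝓗_z = (c₁c₂ + c₃²)` (the quadric cone) and `E_z = (c₀)` (the one carrier
through the vertex), the other carriers missing `z`; and simple normal crossings of `𝓗 :: carriers` at every point over
the closed point other than `z`. [cite: Kollar2007, (3.111) Step 3 and 3.61] -/
structure LadderState {S : Type u} [CommRing S] [IsRegularLocalRing S] (I : Ideal S) (X : Scheme.{u})
    (g : X ⟶ Spec (.of S)) (M 𝓗 E : X.IdealSheafData) (A B : List (X.IdealSheafData × ℕ)) (a b : ℕ) (z : X) :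
    Prop where
  /-- `X` is integral -/
  isIntegral : IsIntegral X
  /-- `X` is Noetherian -/
  isNoetherian : IsNoetherian X
  /-- `X` is regular -/
  isRegular : Scheme.IsRegular X
  /-- `g` is a blowing up along an ideal sheaf cosupported in the closed point -/
  exists_isBlowup : ∃ K₀ : (Spec (.of S)).IdealSheafData, IsBlowup g K₀ ∧
    (K₀.support : Set (Spec (.of S))) ⊆ {IsLocalRing.closedPoint S}
  /-- the invertible factor is locally principal -/
  isLocallyPrincipal : IsLocallyPrincipal M
  /-- the two exponent lists live on the same boundary -/
  boundaryOf_eq : boundaryOf A = boundaryOf B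
  /-- THE FORMAT -/
  format : (affineBlowup.idealSheaf I).comap g =
    M * (𝓗 * monomialIdeal (A ++ [(E, a)]) ⊔ monomialIdeal (B ++ [(E, b)]))
  /-- the vertex is a closed point … -/
  isClosed : IsClosed ({z} : Set X)
  /-- … over the closed point -/
  apply_eq : g z = IsLocalRing.closedPoint S
  /-- at the vertex: a regular system of parameters reading the cone and the carrier -/
  vertex : ∃ c : Fin 4 → X.presheaf.stalk z, IsRegularLocalRing (X.presheaf.stalk z) ∧
    Ideal.span (Set.range c) = maximalIdeal (X.presheaf.stalk z) ∧ (maximalIdeal (X.presheaf.stalk z)).spanFinrank = 4 ∧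
    stalkIdeal 𝓗 z = Ideal.span {c 1 * c 2 + c 3 ^ 2} ∧ stalkIdeal E z = Ideal.span {c 0}
  /-- the other carriers miss the vertex -/
  not_mem_support : ∀ D ∈ boundaryOf A, z ∉ D.support
  /-- simple normal crossings over the closed point, off the vertex -/
  snc : ∀ x : X, g x = IsLocalRing.closedPoint S → x ≠ z → DepthSNC.SNCWithAt (𝓗 :: (boundaryOf A ++ [E])) ⊤ x

namespace LadderState

variable {S : Type u} [CommRing S] [IsRegularLocalRing S] {I : Ideal S} {X : Scheme.{u}} {g : X ⟶ Spec (.of S)}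
  {M 𝓗 E : X.IdealSheafData} {A B : List (X.IdealSheafData × ℕ)} {a b : ℕ} {z : X}

/-- The cone and the carrier through the vertex are different ideal sheaves (`c₀ ∉ 𝔪_z²` while `c₁c₂ + c₃² ∈ 𝔪_z²`).
[cite: Matsumura1987, Thm. 2.3 and §14] -/
theorem host_ne_carrier (h : LadderState I X g M 𝓗 E A B a b z) : 𝓗 ≠ E := by
  obtain ⟨c, hreg, hc, hd, h𝓗, hE⟩ := h.vertex
  intro heq
  have h0 : c 0 ∈ Ideal.span {c 1 * c 2 + c 3 ^ 2} := by
    rw [← h𝓗, heq, hE]; exact Ideal.mem_span_singleton_self _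
  have hsq : c 1 * c 2 + c 3 ^ 2 ∈ maximalIdeal (X.presheaf.stalk z) ^ 2 := by
    have hm : ∀ i, c i ∈ maximalIdeal (X.presheaf.stalk z) := fun i => hc ▸ Ideal.subset_span ⟨i, rfl⟩
    rw [pow_two]
    exact Ideal.add_mem _ (Ideal.mul_mem_mul (hm 1) (hm 2)) (by rw [pow_two]; exact Ideal.mul_mem_mul (hm 3) (hm 3))
  have : c 0 ∈ maximalIdeal (X.presheaf.stalk z) ^ 2 := by
    obtain ⟨r, hr⟩ := Ideal.mem_span_singleton'.mp h0
    rw [← hr]; exact Ideal.mul_mem_left _ _ hsq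
  exact Literature.AlgebraicGeometry.Hironaka2017.S06BaseHike.not_mem_maximalIdeal_sq_of_minimal_generators hc hd 0 this

/-- The vertex lies on the cone. [folklore] -/
theorem mem_support_host (h : LadderState I X g M 𝓗 E A B a b z) : z ∈ 𝓗.support := by
  obtain ⟨c, hreg, hc, hd, h𝓗, -⟩ := h.vertex
  rw [mem_support_iff_stalkIdeal_le, h𝓗, Ideal.span_singleton_le_iff_mem]
  have hm : ∀ i, c i ∈ maximalIdeal (X.presheaf.stalk z) := fun i => hc ▸ Ideal.subset_span ⟨i, rfl⟩
  exact Ideal.add_mem _ (Ideal.mul_mem_left _ _ (hm 2)) (by rw [pow_two]; exact Ideal.mul_mem_left _ _ (hm 3))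

/-- The vertex lies on its carrier. [folklore] -/
theorem mem_support_carrier (h : LadderState I X g M 𝓗 E A B a b z) : z ∈ E.support := by
  obtain ⟨c, hreg, hc, hd, -, hE⟩ := h.vertex
  rw [mem_support_iff_stalkIdeal_le, hE, Ideal.span_singleton_le_iff_mem, ← hc]
  exact Ideal.subset_span ⟨0, rfl⟩

/-- The local ring at the vertex has dimension `4`. [folklore] -/
theorem ringKrullDim_stalk (h : LadderState I X g M 𝓗 E A B a b z) : ringKrullDim (X.presheaf.stalk z) = (4 : ℕ) := by
  obtain ⟨c, hreg, hc, hd, -, -⟩ := h.vertex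
  rw [← IsRegularLocalRing.spanFinrank_maximalIdeal, hd]

/-- The vertex is not the whole space (it is not the generic point: `𝒪_{X,z}` is not a field). [folklore] -/
theorem singleton_ne_univ (h : LadderState I X g M 𝓗 E A B a b z) : ({z} : Set X) ≠ Set.univ := by
  haveI := h.isIntegral
  intro huniv
  have hη : genericPoint X = z := by
    have := Set.eq_univ_iff_forall.mp huniv (genericPoint X)
    simpa using this
  obtain ⟨c, hreg, hc, hd, -, -⟩ := h.vertex
  have hfield : IsField (X.presheaf.stalk z) := by
    rw [← hη]; exact (inferInstance : Field X.functionField).toIsField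
  have hbot : maximalIdeal (X.presheaf.stalk z) = ⊥ := (IsLocalRing.isField_iff_maximalIdeal_eq.mp hfield)
  rw [hbot, Submodule.spanFinrank_bot] at hd
  exact absurd hd (by norm_num)

/-- **THE END applies at exponent `b = 0`**: the conclusion of the blow-up-form core holds for every `T = Bl_I Spec S`.
[cite: Kollar2007, (3.111) Step 3] [cite: StacksProject, Tag 080A] -/
theorem conclusion_of_zero (h : LadderState I X g M 𝓗 E A B a 0 z) (hI : I ≠ ⊥)
    (hIm : ((affineBlowup.idealSheaf I).support : Set (Spec (.of S))) ⊆ {IsLocalRing.closedPoint S})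
    (T : Scheme.{u}) (f : T ⟶ Spec (.of S)) (hf : IsBlowup f (affineBlowup.idealSheaf I)) :
    ∃ (J : T.IdealSheafData) (T' : Scheme.{u}) (π : T' ⟶ T), J ≠ ⊥ ∧
      (∀ t : T, t ∈ J.support → f.base t = IsLocalRing.closedPoint S) ∧
      IsBlowup π J ∧ Scheme.IsRegular T' := by
  haveI := h.isNoetherian
  -- the two lists `(𝓗, 1) :: (A ++ [(E, a)])` and `(𝓗, 0) :: (B ++ [(E, 0)])`
  have hK : 𝓗 * monomialIdeal (A ++ [(E, a)]) ⊔ monomialIdeal (B ++ [(E, 0)]) =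
      monomialIdeal ((𝓗, 1) :: (A ++ [(E, a)])) ⊔ monomialIdeal ((𝓗, 0) :: (B ++ [(E, 0)])) := by
    rw [monomialIdeal_cons, monomialIdeal_cons, pow_one, pow_zero, Scheme.IdealSheafData.one_eq_top,
      Scheme.IdealSheafData.top_mul]
  have hfmt := h.format
  rw [hK] at hfmt
  refine coneEnd hI h.isRegular h.exists_isBlowup h.isLocallyPrincipal _ _ ?_ ?_ ?_ hfmt T f hf
  · show 𝓗 :: boundaryOf (A ++ [(E, a)]) = 𝓗 :: boundaryOf (B ++ [(E, 0)])
    rw [boundaryOf_append, boundaryOf_append, h.boundaryOf_eq]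
    rfl
  · intro x hx
    -- `x` lies over the closed point and is not the vertex
    have hxI : x ∈ ((affineBlowup.idealSheaf I).comap g).support := by
      rw [hfmt, Scheme.IdealSheafData.support_mul]
      exact Or.inr hx
    have hgx : g x = IsLocalRing.closedPoint S := by
      rw [Scheme.IdealSheafData.support_comap] at hxI
      exact hIm hxI
    have hxz : x ≠ z := by
      rintro rfl
      -- at the vertex the `B`-monomial is the unit ideal
      rw [← hK] at hx
      have hB : stalkIdeal (monomialIdeal (B ++ [(E, 0)])) x = ⊤ := by
        rw [stalkIdeal_monomialIdeal, List.map_append, List.prod_append, List.map_singleton, List.prod_singleton,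
          pow_zero, mul_one, ← Ideal.one_eq_top]
        refine List.prod_eq_one fun J hJ => ?_
        obtain ⟨p, hp, rfl⟩ := List.mem_map.mp hJ
        have hD : x ∉ p.1.support := h.not_mem_support p.1 (h.boundaryOf_eq ▸ fst_mem_boundaryOf hp)
        rw [stalkIdeal_eq_top_of_not_mem_support hD, Ideal.top_pow, Ideal.one_eq_top]
      rw [mem_support_iff_stalkIdeal_ne_top, stalkIdeal_sup, hB] at hx
      exact hx (sup_top_eq _)
    have := h.snc x hgx hxz
    show DepthSNC.SNCWithAt (𝓗 :: boundaryOf (A ++ [(E, a)])) ⊤ x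
    rwa [boundaryOf_append]
  · intro x hx
    have hxI : x ∈ ((affineBlowup.idealSheaf I).comap g).support := by
      rw [hfmt, Scheme.IdealSheafData.support_mul]
      exact Or.inr hx
    rw [Scheme.IdealSheafData.support_comap] at hxI
    exact hIm hxI

end LadderState

/-- The format algebra of one rung step, in any commutative semiring. [folklore] -/
theorem step_algebra {R : Type*} [CommSemiring R] (M H P Q En Et : R) {a b m k₁ k₂ : ℕ}
    (ha : a + 2 = m + k₁) (hb : b = m + k₂) :
    M * (En ^ 2 * H * (P * (En * Et) ^ a) + Q * (En * Et) ^ b) =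
      M * En ^ m * (H * (P * Et ^ a * En ^ k₁) + Q * Et ^ b * En ^ k₂) := by
  have h1 : En ^ 2 * (En * Et) ^ a = En ^ m * En ^ k₁ * Et ^ a := by
    rw [mul_pow, ← mul_assoc, ← pow_add, show 2 + a = m + k₁ by omega, pow_add]
  have h2 : (En * Et) ^ b = En ^ m * En ^ k₂ * Et ^ b := by
    rw [mul_pow, hb, pow_add]
  calc M * (En ^ 2 * H * (P * (En * Et) ^ a) + Q * (En * Et) ^ b)
      = M * (H * P * (En ^ 2 * (En * Et) ^ a) + Q * (En * Et) ^ b) := by ring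
    _ = M * (H * P * (En ^ m * En ^ k₁ * Et ^ a) + Q * (En ^ m * En ^ k₂ * Et ^ b)) := by rw [h1, h2]
    _ = M * En ^ m * (H * (P * Et ^ a * En ^ k₁) + Q * Et ^ b * En ^ k₂) := by ring

namespace LadderState

variable {S : Type u} [CommRing S] [IsRegularLocalRing S] {I : Ideal S} {X : Scheme.{u}} {g : X ⟶ Spec (.of S)}
  {M 𝓗 E : X.IdealSheafData} {A B : List (X.IdealSheafData × ℕ)} {a b : ℕ} {z : X}

/-- **ONE RUNG: blowing up the vertex.**  Given a state at the vertex `z` (exponents `a`, `b`) and a blowing up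
`σ : X' ⟶ X` of the reduced point `z` for which the VERTEX FIBRE THEOREM holds (hypothesis `hfib`, discharged by
`ConeDepth.vertex_fibre`), the transformed data form a state on `X'` at the new vertex `z'`: `g' = σ ≫ g`,
`M' = σ^*M · 𝓘_{E'}^m` (`m = min (a+2) b`, `E' = σ^*𝓘_z` the new exceptional divisor), host `σᶜ(𝓗, 2)`, carriers the
pull-backs of the old ones and the strict transform `σᶜ(E, 1)` of the old vertex carrier (exponents `a`, `b`), the new
vertex carrier `E'` with exponents `(a + 2 - m, b - m)`.  Bookkeeping: `σ^*𝓗 = E'² σᶜ(𝓗,2)` and `σ^*E = E' σᶜ(E,1)`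
(`pow_mul_controlledTransform_eq`, as `𝓗 ≤ 𝓘_z²`, `E ≤ 𝓘_z`); `X'` is integral, Noetherian and regular (blowing up a
regular closed point, Liu Thm. 8.1.19 (a)); `z'` is closed (same local dimension over a closed point); simple normal
crossings off `z'`: over `z` by `hfib`, elsewhere transported through the stalk isomorphism (`sncWithAt_map_of_isIso`).
[cite: Kollar2007, 3.61 and (3.111) Step 3] [cite: Liu2002, Thm. 8.1.19 (a)] [cite: StacksProject, Tag 080B] -/
theorem step (h : LadderState I X g M 𝓗 E A B a b z) {X' : Scheme.{u}} {σ : X' ⟶ X}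
    (hσ : IsBlowup σ (vanishingIdeal (⟨{z}, h.isClosed⟩ : Closeds X)))
    (hfib : ∃ z' : X', σ z' = z ∧
      (∃ c' : Fin 4 → X'.presheaf.stalk z',
        IsRegularLocalRing (X'.presheaf.stalk z') ∧ Ideal.span (Set.range c') = maximalIdeal _ ∧
        (maximalIdeal (X'.presheaf.stalk z')).spanFinrank = 4 ∧
        stalkIdeal ((vanishingIdeal (⟨{z}, h.isClosed⟩ : Closeds X)).comap σ) z' = Ideal.span {c' 0} ∧
        stalkIdeal (controlledTransform σ (vanishingIdeal (⟨{z}, h.isClosed⟩ : Closeds X)) 𝓗 2) z' =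
          Ideal.span {c' 1 * c' 2 + c' 3 ^ 2} ∧
        stalkIdeal (controlledTransform σ (vanishingIdeal (⟨{z}, h.isClosed⟩ : Closeds X)) E 1) z' = ⊤) ∧
      ∀ x' : X', σ x' = z → x' ≠ z' →
        DepthSNC.SNCWithAt [controlledTransform σ (vanishingIdeal (⟨{z}, h.isClosed⟩ : Closeds X)) 𝓗 2,
          (vanishingIdeal (⟨{z}, h.isClosed⟩ : Closeds X)).comap σ,
          controlledTransform σ (vanishingIdeal (⟨{z}, h.isClosed⟩ : Closeds X)) E 1] ⊤ x') :
    ∃ z' : X', LadderState I X' (σ ≫ g)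
      (M.comap σ * (vanishingIdeal (⟨{z}, h.isClosed⟩ : Closeds X)).comap σ ^ min (a + 2) b)
      (controlledTransform σ (vanishingIdeal (⟨{z}, h.isClosed⟩ : Closeds X)) 𝓗 2)
      ((vanishingIdeal (⟨{z}, h.isClosed⟩ : Closeds X)).comap σ)
      (comapExp A σ ++ [(controlledTransform σ (vanishingIdeal (⟨{z}, h.isClosed⟩ : Closeds X)) E 1, a)])
      (comapExp B σ ++ [(controlledTransform σ (vanishingIdeal (⟨{z}, h.isClosed⟩ : Closeds X)) E 1, b)])
      (a + 2 - min (a + 2) b) (b - min (a + 2) b) z' := by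
  classical
  -- notation
  set J : X.IdealSheafData := vanishingIdeal (⟨{z}, h.isClosed⟩ : Closeds X) with hJdef
  set En : X'.IdealSheafData := J.comap σ with hEn
  set 𝓗' : X'.IdealSheafData := controlledTransform σ J 𝓗 2 with h𝓗'
  set Et : X'.IdealSheafData := controlledTransform σ J E 1 with hEt
  set m : ℕ := min (a + 2) b with hm
  haveI := h.isIntegral
  haveI := h.isNoetherian
  haveI : IsProper σ := hσ.isProper
  haveI : IsLocallyNoetherian X' := LocallyOfFiniteType.isLocallyNoetherian σ
  have hsuppJ : ∀ x : X, x ∈ J.support ↔ x = z := mem_support_vanishingIdeal_singleton_iff h.isClosed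
  obtain ⟨c, hreg, hc, hd, h𝓗z, hEz⟩ := h.vertex
  obtain ⟨z', hσz', ⟨c', hreg', hc', hd', hEn', h𝓗'z, hEt'⟩, hsnc'⟩ := hfib
  -- the two transform identities
  have hH : En ^ 2 * 𝓗' = 𝓗.comap σ := by
    refine pow_mul_controlledTransform_eq σ J hσ.isEffectiveCartier ?_
    rw [← comap_pow]
    refine Scheme.IdealSheafData.comap_mono σ (le_vanishingIdeal_singleton_pow h.isClosed 𝓗 2 ?_)
    rw [h𝓗z, Ideal.span_singleton_le_iff_mem, pow_two]
    have hmz : ∀ i, c i ∈ maximalIdeal (X.presheaf.stalk z) := fun i => hc ▸ Ideal.subset_span ⟨i, rfl⟩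
    exact Ideal.add_mem _ (Ideal.mul_mem_mul (hmz 1) (hmz 2)) (by rw [pow_two]; exact Ideal.mul_mem_mul (hmz 3) (hmz 3))
  have hE : En ^ 1 * Et = E.comap σ := by
    refine pow_mul_controlledTransform_eq σ J hσ.isEffectiveCartier ?_
    rw [← comap_pow]
    refine Scheme.IdealSheafData.comap_mono σ (le_vanishingIdeal_singleton_pow h.isClosed E 1 ?_)
    rw [hEz, pow_one, Ideal.span_singleton_le_iff_mem, ← hc]
    exact Ideal.subset_span ⟨0, rfl⟩
  rw [pow_one] at hE
  refine ⟨z', ?_⟩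
  have hz'cl : IsClosed ({z'} : Set X') := by
    refine hσ.isClosed_singleton_of_ringKrullDim_eq (x' := z') (by rw [hσz']; exact h.isClosed) ?_
    rw [hσz', h.ringKrullDim_stalk, ← IsRegularLocalRing.spanFinrank_maximalIdeal, hd']
  refine
    { isIntegral := hσ.isIntegral (vanishingIdeal_singleton_ne_bot h.isClosed h.singleton_ne_univ)
      isNoetherian := ?_
      isRegular := IsBlowup.isRegular_of_isRegular_subscheme h.isRegular
        (isRegular_subscheme_vanishingIdeal_singleton h.isClosed) hσ
      exists_isBlowup := ?_
      isLocallyPrincipal := (h.isLocallyPrincipal.comap σ).mul (hσ.isEffectiveCartier.isLocallyPrincipal.pow _)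
      boundaryOf_eq := by
        rw [boundaryOf_append, boundaryOf_append, boundaryOf_comapExp, boundaryOf_comapExp, h.boundaryOf_eq]; rfl
      format := ?_
      isClosed := hz'cl
      apply_eq := by rw [Scheme.Hom.comp_apply, hσz', h.apply_eq]
      vertex := ⟨c', hreg', hc', hd', h𝓗'z, hEn'⟩
      not_mem_support := ?_
      snc := ?_ }
  · -- Noetherian
    haveI : CompactSpace X' := QuasiCompact.compactSpace_of_compactSpace σ
    exact {}
  · -- a blowing up cosupported in the closed point
    obtain ⟨K₀, hg, hK₀⟩ := h.exists_isBlowup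
    exact IsBlowup.exists_isBlowup_comp_supported g K₀ σ J {IsLocalRing.closedPoint S} hg hK₀ hσ fun x hx => by
      rw [(hsuppJ x).mp hx]; exact h.apply_eq
  · -- THE FORMAT
    have ha : a + 2 = m + (a + 2 - m) := by omega
    have hb : b = m + (b - m) := by omega
    rw [Scheme.IdealSheafData.comap_comp, h.format, comap_mul, Scheme.IdealSheafData.comap_sup, comap_mul,
      ← monomialIdeal_comapExp, ← monomialIdeal_comapExp]
    simp only [comapExp_append, comapExp_cons, comapExp_nil, monomialIdeal_append, monomialIdeal_singleton]
    rw [← hH, ← hE, ← Scheme.IdealSheafData.add_eq_sup, ← Scheme.IdealSheafData.add_eq_sup]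
    exact step_algebra (M.comap σ) 𝓗' (monomialIdeal (comapExp A σ)) (monomialIdeal (comapExp B σ)) En Et ha hb
  · -- the other carriers miss the new vertex
    intro D hD
    rw [boundaryOf_append, boundaryOf_comapExp, show boundaryOf [(Et, a)] = [Et] from rfl] at hD
    rcases List.mem_append.mp hD with hD | hD
    · obtain ⟨D₀, hD₀, rfl⟩ := List.mem_map.mp hD
      rw [mem_support_comap_iff_apply, hσz']
      exact h.not_mem_support D₀ hD₀
    · rw [List.mem_singleton] at hD
      subst hD
      rw [mem_support_iff_stalkIdeal_ne_top, hEt']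
      exact fun hne => hne rfl
  · -- simple normal crossings over the closed point off the new vertex
    intro x' hgx' hne
    rw [boundaryOf_append, boundaryOf_comapExp, show boundaryOf [(Et, a)] = [Et] from rfl]
    -- membership in the new boundary list, once and for all
    have hcases : ∀ D ∈ 𝓗' :: (((boundaryOf A).map fun K => K.comap σ) ++ [Et] ++ [En]),
        D = 𝓗' ∨ (∃ D₀ ∈ boundaryOf A, D = D₀.comap σ) ∨ D = Et ∨ D = En := by
      intro D hD
      rcases List.mem_cons.mp hD with rfl | hD
      · exact Or.inl rfl
      rcases List.mem_append.mp hD with hD | hD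
      · rcases List.mem_append.mp hD with hD | hD
        · obtain ⟨D₀, hD₀, rfl⟩ := List.mem_map.mp hD
          exact Or.inr (Or.inl ⟨D₀, hD₀, rfl⟩)
        · exact Or.inr (Or.inr (Or.inl (List.mem_singleton.mp hD)))
      · exact Or.inr (Or.inr (Or.inr (List.mem_singleton.mp hD)))
    by_cases hx : σ x' = z
    · -- over the old vertex: the vertex fibre theorem
      refine (hsnc' x' hx hne).anti fun D hD hxD => ?_
      rcases hcases D hD with rfl | ⟨D₀, hD₀, rfl⟩ | rfl | rfl
      · exact List.mem_cons_self
      · exfalso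
        rw [mem_support_comap_iff_apply, hx] at hxD
        exact h.not_mem_support D₀ hD₀ hxD
      · exact List.mem_cons_of_mem _ (List.mem_cons_of_mem _ (List.mem_singleton_self _))
      · exact List.mem_cons_of_mem _ List.mem_cons_self
    · -- elsewhere: transport through the stalk isomorphism
      have hxJ : σ x' ∉ J.support := fun hmem => hx ((hsuppJ _).mp hmem)
      haveI := hσ.isIso_stalkMap_of_not_mem_support hxJ
      have hgx : g (σ x') = IsLocalRing.closedPoint S := by rwa [Scheme.Hom.comp_apply] at hgx'
      have hold := h.snc (σ x') hgx hx
      let τ : X.IdealSheafData → X'.IdealSheafData := fun D =>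
        if D = E then Et else if D = 𝓗 then 𝓗' else D.comap σ
      have hτE : τ E = Et := by simp only [τ, if_pos rfl]
      have hτH : τ 𝓗 = 𝓗' := by
        show (if 𝓗 = E then Et else if 𝓗 = 𝓗 then 𝓗' else 𝓗.comap σ) = 𝓗'
        rw [if_neg h.host_ne_carrier, if_pos rfl]
      have hτD : ∀ D ∈ boundaryOf A, τ D = D.comap σ := by
        intro D hD
        have h1 : D ≠ E := fun heq => h.not_mem_support D hD (heq ▸ h.mem_support_carrier)
        have h2 : D ≠ 𝓗 := fun heq => h.not_mem_support D hD (heq ▸ h.mem_support_host)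
        simp only [τ, if_neg h1, if_neg h2]
      have key := sncWithAt_map_of_isIso x' hold τ ?_ [En] ?_
      · refine key.anti fun D hD _ => ?_
        rcases hcases D hD with rfl | ⟨D₀, hD₀, rfl⟩ | rfl | rfl
        · rw [← hτH]
          exact List.mem_append_left _ (List.mem_map_of_mem List.mem_cons_self)
        · rw [← hτD D₀ hD₀]
          exact List.mem_append_left _ (List.mem_map_of_mem (List.mem_cons_of_mem _ (List.mem_append_left _ hD₀)))
        · rw [← hτE]
          exact List.mem_append_left _
            (List.mem_map_of_mem (List.mem_cons_of_mem _ (List.mem_append_right _ (List.mem_singleton_self _))))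
        · exact List.mem_append_right _ (List.mem_singleton_self _)
      · -- stalks of the transforms off the exceptional divisor
        intro D hD _
        by_cases hDE : D = E
        · subst hDE
          rw [hτE]
          exact stalkIdeal_controlledTransform_of_not_mem_support _ 1 hxJ
        · by_cases hDH : D = 𝓗
          · subst hDH
            rw [hτH]
            exact stalkIdeal_controlledTransform_of_not_mem_support _ 2 hxJ
          · simp only [τ, if_neg hDE, if_neg hDH]
            exact stalkIdeal_comap_eq_map_stalkMap σ D x'
      · intro D hD
        rw [List.mem_singleton] at hD
        subst hD
        rw [mem_support_comap_iff_apply]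
        exact hxJ

end LadderState


end ConeDepth

end Summit.ResolutionOfSingularities.ResolutionOfSingularities.Theorems

end
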